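import Mathlib
import Summits.Ventures.HodgeRepro2.T6N5Hyp
import Summits.Ventures.HodgeRepro2.T6N5Rich

/-!
# T6N5RichToy — non-vacuity witness for the rich N5 datum (README §10.5(ii)(c)/(d)): a model rich datum on
which EVERY hypothesis of `N5Rich.RichData.N5_of` holds jointly

Tier 6 (README §10), sub-step N5 of the M2 discharge (t6-p7).  The carriers of `T6N5Rich` are instantiated
— the representation carrier on `V = ℂ` with one level (`fix = ⊤`), the identity projector and the identity
functional; a local sign datum whose characters are `ℤˣ` with trivial restriction, trivial `η` and root
number `+1`; a sign model over three places, one of each kind (finite non-split, split, real) — and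
Theorem 5.6's shape on both sides, the construction facts, (S–H), the local solutions, (b) at the real
places and (c) are all proved on it (`joint_toy`), so N5 follows (`toy_N5`).  Count-neutral; no display is
asserted (the display `Hyp.BFGYYZ2025_Thm5_6` is PROVED on the toy's two sides, as a witness of
satisfiability, not assumed).
§8(d): uses an L-value-free non-vanishing device: NO.
-/

namespace Summit.Ventures.HodgeRepro2.T6.N5RichToy

open Summit.Ventures.HodgeRepro2.T6.N5Skeleton Summit.Ventures.HodgeRepro2.T6.N5Rich
  Summit.Ventures.HodgeRepro2.T6.N5LocalDatum Summit.Ventures.HodgeRepro2.T6.N5Local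

/-- The toy representation carrier: `V = ℂ`, one level `⊤`, the identity projector, the identity
functional. -/
def toyRep : RepCarrier where
  V := ℂ
  κ := Unit
  fix := fun _ => ⊤
  e := LinearMap.id
  P := LinearMap.id

/-- The toy carrier satisfies the four construction facts. -/
theorem toyRep_levelHyps : toyRep.LevelHyps where
  smooth := by
    show (⨆ _ : Unit, (⊤ : Submodule ℂ ℂ)) = ⊤
    exact iSup_const
  projector := fun _ => rfl
  stable := fun _ _ _ => trivial
  equivariant := fun _ => rfl

/-- The toy period functional is non-zero. -/
theorem toyRep_periodNonzero : toyRep.periodNonzero := fun h =>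
  one_ne_zero (LinearMap.congr_fun h (1 : ℂ))

/-- The toy local sign datum: characters `ℤˣ` with the identity restriction, trivial `η`, root number `+1`
everywhere, trivial `χ_W`, `ϵ_δ(W) = 1`, every theta lift non-zero, trivial line signs. -/
def toyLocal : LocalSignDatum where
  Char := ℤˣ
  FChar := ℤˣ
  res := MonoidHom.id ℤˣ
  η := 1
  eps := fun _ => 1
  χW := 1
  epsdW := 1
  Theta := fun _ _ => True
  ηLine := fun _ => 1
  ηu := 1

/-- The trivial quadruple solves the toy's coupled local system. -/
theorem toyLocal_solution : LocalSolution toyLocal (fun _ => 1) := by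
  refine ⟨fun _ => rfl, rfl, rfl, ?_, ?_, rfl⟩ <;> simp [toyLocal]

/-- The toy sign model: three places — `0` finite non-split, `1` split, `2` real — the toy local datum
everywhere, trivial characters and trivial real-place signs. -/
def toySign : SignModel (Fin 3) where
  kind := ![PlaceKind.ns, PlaceKind.sp, PlaceKind.re]
  D := fun _ => toyLocal
  ξ := fun _ _ => 1
  omegaRA := fun _ _ => 1
  epsRA := fun _ _ => 1
  omegaRB := fun _ _ => 1
  epsRB := fun _ _ => 1

/-- The toy sign model's characters solve the local system at its finite non-split place. -/
theorem toySign_solves : toySign.Solves := fun _ _ => toyLocal_solution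

/-- Condition (b) holds at the toy's real place. -/
theorem toySign_realCondB : toySign.RealCondB := fun _ _ _ => ⟨rfl, rfl⟩

/-- The toy rich datum: the toy carrier on both sides, the toy sign model, trivial characters, central
values `1`. -/
def toy : RichData (Fin 3) ℤˣ where
  repA := toyRep
  repB := toyRep
  S := toySign
  f := 1
  rA := 1
  rB := 1
  LvalA := fun _ => 1
  LvalB := fun _ => 1

/-- (c) on the toy: `1 · 1 ≠ 0` on both sides. -/
theorem toy_condC : toy.toN5Data.condC :=
  ⟨ToricSide.condC_of_ne_zero fun _ => one_ne_zero, ToricSide.condC_of_ne_zero fun _ => one_ne_zero⟩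

/-- Theorem 5.6's shape holds on the toy's side A (both sides of the equivalence are true). -/
theorem toy_sideA_dichotomy : toy.sideA.dichotomy :=
  iff_of_true toyRep_periodNonzero
    ⟨toy.sideA_condA, toy.sideA_condB toySign_solves toySign_realCondB, toy_condC.1⟩

/-- Theorem 5.6's shape holds on the toy's side B. -/
theorem toy_sideB_dichotomy : toy.sideB.dichotomy :=
  iff_of_true toyRep_periodNonzero
    ⟨toy.sideB_condA rfl, toy.sideB_condB toySign_solves toySign_realCondB, toy_condC.2⟩

/-- The display `Hyp.BFGYYZ2025_Thm5_6` holds on the set of the toy's two sides. -/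
theorem toy_thm5_6 : Hyp.BFGYYZ2025_Thm5_6 ({toy.sideA, toy.sideB} : Set (ToricSide (Fin 3) ℤˣ)) := by
  intro X hX
  rcases hX with rfl | rfl
  · exact toy_sideA_dichotomy
  · exact toy_sideB_dichotomy

/-- JOINT NON-VACUITY (README §10.5(ii)(d)): every hypothesis of `RichData.N5_of` — and of
`N5RichMain.N5_of_rich` on a carrier whose `d5` is `toy.toN5Data` — holds on the toy at once. -/
theorem joint_toy :
    Hyp.BFGYYZ2025_Thm5_6 ({toy.sideA, toy.sideB} : Set (ToricSide (Fin 3) ℤˣ)) ∧ toy.LevelHyps ∧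
      toy.SH ∧ toy.S.Solves ∧ toy.S.RealCondB ∧ toy.toN5Data.condC :=
  ⟨toy_thm5_6, ⟨toyRep_levelHyps, toyRep_levelHyps⟩, rfl, toySign_solves, toySign_realCondB, toy_condC⟩

/-- N5 holds on the toy (the conclusion of `RichData.N5_of` instantiated). -/
theorem toy_N5 : toy.toN5Data.N5 :=
  toy.N5_of toy_sideA_dichotomy toy_sideB_dichotomy ⟨toyRep_levelHyps, toyRep_levelHyps⟩ rfl
    toySign_solves toySign_realCondB toy_condC

end Summit.Ventures.HodgeRepro2.T6.N5RichToy
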